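/-
Copyright (c) 2026 the pub-hodgecm-mathlib formalisation cell (harness21).  Prover seat hodgecm-mathlib-F0P3a-p02 (g18): road «S3-ram», (Cnt2′) ROUTE B (chair
F0P3a-p07 (g15) RULING (17)(a)(b): the FINITE half of the type-(2) root collar census without centring): the AFFINE quartic-to-cubic transfer; 2026-09-02.
-/
import Literature.FieldTheory.FiniteFields.ConicCharacterSumTransfer   -- ★ p849208 (this seat): the linear case, `card_filter_sq_eq`
import HarnessLib

/-!
# The affine quartic-to-cubic transfer of quadratic character sums through a conic (Lidl–Niederreiter Ch. 5 §4, Ch. 6 §2; Ireland–Rosen Ch. 8)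

Topic `FieldTheory/FiniteFields`; namespace `Literature.FieldTheory.FiniteFields.ConicTransfer` (continues ★ `ConicCharacterSumTransfer`).  THEOREMS ONLY (no definition, no
instance, no notation, no named fact, no `sorry`); kernel lane `--supports stmt-HodgeConjecture-24833` (cell `pub/hodgecm-mathlib`, crux H413, road «S3-ram», count-neutral:
the finite half of the type-(2) root collar census for a NON-centred residual block, chair RULING (17); statement-first v2
`F0/P3a/F0P3a-p02/g18/census/BlockRootCensus.statementfirst.v2.F0P3ap02g18.lean`).

THE MATHEMATICS (`F` finite of odd characteristic, `η` the quadratic character, `d ≠ 0`).  ★ `quadraticChar_quartic_transfer` is the case `γ = −α` of: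
**`η(α) + Σ_x η((x² + d)(αx² + 2dyx + γd)) = η(−2d)·Σ_v η(v + α + γ)·η(v² − ((α − γ)² + 4dy²))`** whenever `(α − γ)² + 4dy² ≠ 0`.  The proof is the same conic
argument, made GENERIC in the summand: §1 `Σ_{u² + dv² = e} g(u) = Σ_u (1 + η(d(e − u²)))·g(u)` and hence `Σ_{u² + dv² = e} η(u + τ) = η(−d)·Σ_u η(u + τ)η(u² − e)`;
§2 the norm-multiplying substitution `Σ_{U² + dV² = 1} g(aU + dyV) = Σ_{u² + dv² = a² + dy²} g(u)`; §3 the rational parametrisation `Σ_{U² + dV² = 1} G(U,V) = G(1,0) +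
Σ_{x² + d ≠ 0} G((x² − d)∕(x² + d), 2x∕(x² + d))` and `2(x² + d)(αx² + 2dyx + γd) = ((α + γ) + (α − γ)U + 2dyV)·(x² + d)²`; §4 the transfer.  The right-hand side is an
elliptic character sum (`y² = (v + τ)(v² − D)`), NOT a Jacobsthal sum unless `τ = 0` — this is the `b₀`-dependence of the per-literal class splits observed by the chair
(RULING (17)(v)); only cross-literal differences are free of it.
HONEST LABEL: HC_CM is proved only modulo the 2 remaining named inputs (hLiu418 24832, h413 24833) until rung 0 closes; finite-field algebra only, nothing printed is asserted.

## References
* [LidlNiederreiter1996] R. Lidl, H. Niederreiter, *Finite Fields*, 2nd ed., Ch. 5 §4 (Thm. 5.48, Def. 5.49), Ch. 6 §2 (Thm. 6.26∕6.27: points on conics).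
* [IrelandRosen1990] K. Ireland, M. Rosen, *A Classical Introduction to Modern Number Theory*, GTM 84, Ch. 8 §1–§3, Ch. 18 §2 (character sums on conics and cubics).
-/

set_option autoImplicit false

namespace Literature.FieldTheory.FiniteFields.ConicTransfer

open Finset

variable {F : Type*} [Field F] [Fintype F] [DecidableEq F]

/-! ## §1 Summing a function of the first coordinate over a conic -/

/-- `Σ_{u² + dv² = e} g(u) = Σ_u (1 + η(d(e − u²)))·g(u)` (`d ≠ 0`): the fibre over `u` has `#{v : dv² = e − u²} = 1 + η(d(e − u²))` points.
[cite: LidlNiederreiter1996, Ch. 6 §2 Thm. 6.26] [cite: IrelandRosen1990, Ch. 8 §1] -/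
theorem sum_conic_fst_comp (hF : ringChar F ≠ 2) {d : F} (hd : d ≠ 0) (e : F) (g : F → ℤ) :
    ∑ p ∈ univ.filter (fun p : F × F => p.1 ^ 2 + d * p.2 ^ 2 = e), g p.1 = ∑ u : F, (1 + quadraticChar F (d * (e - u ^ 2))) * g u := by
  have hfib : ∀ u : F, ((univ.filter fun v : F => u ^ 2 + d * v ^ 2 = e).card : ℤ) = 1 + quadraticChar F (d * (e - u ^ 2)) := by
    intro u
    have hset : (univ.filter fun v : F => u ^ 2 + d * v ^ 2 = e) = univ.filter fun v : F => v ^ 2 = d⁻¹ * (e - u ^ 2) := by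
      refine Finset.filter_congr fun v _ => ⟨fun h => ?_, fun h => ?_⟩
      · rw [← h]; field_simp; ring
      · rw [h]; field_simp; ring
    rw [hset, card_filter_sq_eq hF, show d⁻¹ * (e - u ^ 2) = d * (e - u ^ 2) * d⁻¹ ^ 2 by field_simp, map_mul, map_pow,
      quadraticChar_sq_one (inv_ne_zero hd), mul_one]
  have hinner : ∀ u : F, ∑ v : F, (if u ^ 2 + d * v ^ 2 = e then g u else 0) = ((univ.filter fun v : F => u ^ 2 + d * v ^ 2 = e).card : ℤ) * g u := by
    intro u
    rw [Finset.sum_ite, Finset.sum_const_zero, add_zero, Finset.sum_const, nsmul_eq_mul]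
  rw [Finset.sum_filter, Fintype.sum_prod_type]
  dsimp only
  simp_rw [hinner, hfib]

/-- **`Σ_{u² + dv² = e} η(u + τ) = η(−d)·Σ_u η(u + τ)·η(u² − e)`** (`d ≠ 0`; an elliptic character sum when `τ ≠ 0`, the Jacobsthal sum `H₂(−e)` when `τ = 0`).
[cite: LidlNiederreiter1996, Ch. 5 §4 Def. 5.49] [cite: IrelandRosen1990, Ch. 18 §2] -/
theorem sum_quadraticChar_fst_add_of_conic (hF : ringChar F ≠ 2) {d : F} (hd : d ≠ 0) (e τ : F) :
    ∑ p ∈ univ.filter (fun p : F × F => p.1 ^ 2 + d * p.2 ^ 2 = e), quadraticChar F (p.1 + τ) =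
      quadraticChar F (-d) * ∑ u : F, quadraticChar F (u + τ) * quadraticChar F (u ^ 2 - e) := by
  rw [sum_conic_fst_comp hF hd e (fun u => quadraticChar F (u + τ))]
  have hstep : ∀ u : F, (1 + quadraticChar F (d * (e - u ^ 2))) * quadraticChar F (u + τ) =
      quadraticChar F (u + τ) + quadraticChar F (-d) * (quadraticChar F (u + τ) * quadraticChar F (u ^ 2 - e)) := fun u => by
    rw [show d * (e - u ^ 2) = -d * (u ^ 2 - e) by ring, map_mul]; ring
  have hshift : ∑ u : F, quadraticChar F (u + τ) = 0 := by
    rw [show ∑ u : F, quadraticChar F (u + τ) = ∑ u : F, (fun v => quadraticChar F v) (Equiv.addRight τ u) from rfl, Equiv.sum_comp,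
      quadraticChar_sum_zero hF]
  simp_rw [hstep]
  rw [Finset.sum_add_distrib, hshift, zero_add, ← Finset.mul_sum]

/-! ## §2 The norm-multiplying linear substitution, generic summand -/

/-- **`Σ_{U² + dV² = 1} g(aU + dyV) = Σ_{u² + dv² = e} g(u)`**, `e = a² + dy² ≠ 0`, for ANY `g`: the linear map `(U,V) ↦ (aU + dyV, aV − yU)` is a bijection of the unit
conic onto the conic of norm `e`. [cite: IrelandRosen1990, Ch. 8 §3] [cite: LidlNiederreiter1996, Ch. 6 §2] -/
theorem sum_unitConic_comp_linear (d a y : F) (he : a ^ 2 + d * y ^ 2 ≠ 0) (g : F → ℤ) :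
    ∑ p ∈ univ.filter (fun p : F × F => p.1 ^ 2 + d * p.2 ^ 2 = 1), g (a * p.1 + d * y * p.2) =
      ∑ p ∈ univ.filter (fun p : F × F => p.1 ^ 2 + d * p.2 ^ 2 = a ^ 2 + d * y ^ 2), g p.1 := by
  refine Finset.sum_bij (fun p _ => (a * p.1 + d * y * p.2, a * p.2 - y * p.1)) (fun p hp => ?_) (fun p₁ hp₁ p₂ hp₂ h => ?_) (fun p hp => ?_) (fun p hp => rfl)
  · rw [Finset.mem_filter] at hp ⊢
    refine ⟨Finset.mem_univ _, ?_⟩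
    have h := hp.2
    linear_combination (a ^ 2 + d * y ^ 2) * h
  · obtain ⟨h1, h2⟩ := Prod.ext_iff.1 h
    simp only at h1 h2
    have hu : (a ^ 2 + d * y ^ 2) * p₁.1 = (a ^ 2 + d * y ^ 2) * p₂.1 := by linear_combination a * h1 - d * y * h2
    have hv : (a ^ 2 + d * y ^ 2) * p₁.2 = (a ^ 2 + d * y ^ 2) * p₂.2 := by linear_combination y * h1 + a * h2
    exact Prod.ext (mul_left_cancel₀ he hu) (mul_left_cancel₀ he hv)
  · rw [Finset.mem_filter] at hp
    refine ⟨((a * p.1 - d * y * p.2) / (a ^ 2 + d * y ^ 2), (a * p.2 + y * p.1) / (a ^ 2 + d * y ^ 2)), ?_, ?_⟩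
    · rw [Finset.mem_filter]
      refine ⟨Finset.mem_univ _, ?_⟩
      show ((a * p.1 - d * y * p.2) / (a ^ 2 + d * y ^ 2)) ^ 2 + d * ((a * p.2 + y * p.1) / (a ^ 2 + d * y ^ 2)) ^ 2 = 1
      rw [div_pow, div_pow, mul_div_assoc', ← add_div, div_eq_one_iff_eq (pow_ne_zero 2 he)]
      linear_combination (a ^ 2 + d * y ^ 2) * hp.2
    · refine Prod.ext ?_ ?_
      · show a * ((a * p.1 - d * y * p.2) / (a ^ 2 + d * y ^ 2)) + d * y * ((a * p.2 + y * p.1) / (a ^ 2 + d * y ^ 2)) = p.1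
        rw [mul_div_assoc', mul_div_assoc', ← add_div, div_eq_iff he]
        ring
      · show a * ((a * p.2 + y * p.1) / (a ^ 2 + d * y ^ 2)) - y * ((a * p.1 - d * y * p.2) / (a ^ 2 + d * y ^ 2)) = p.2
        rw [mul_div_assoc', mul_div_assoc', ← sub_div, div_eq_iff he]
        ring

/-! ## §3 The rational parametrisation of the unit conic, generic summand -/

/-- **`Σ_{U² + dV² = 1} G(U,V) = G(1,0) + Σ_{x : x² + d ≠ 0} G((x² − d)∕(x² + d), 2x∕(x² + d))`** (`d ≠ 0`, odd characteristic): the rational parametrisation of the unit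
conic from the point `(1,0)` is a bijection `{x : x² + d ≠ 0} → {U² + dV² = 1} ∖ {(1,0)}`. [cite: LidlNiederreiter1996, Ch. 6 §2 Thm. 6.26] [cite: IrelandRosen1990, Ch. 8 §3] -/
theorem sum_unitConic_eq_parametrisation (hF : ringChar F ≠ 2) {d : F} (hd : d ≠ 0) (G : F × F → ℤ) :
    ∑ p ∈ univ.filter (fun p : F × F => p.1 ^ 2 + d * p.2 ^ 2 = 1), G p =
      G (1, 0) + ∑ x ∈ univ.filter (fun x : F => x ^ 2 + d ≠ 0), G ((x ^ 2 - d) / (x ^ 2 + d), 2 * x / (x ^ 2 + d)) := by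
  have h20 : (2 : F) ≠ 0 := Ring.two_ne_zero hF
  have hne_one : ∀ x : F, x ^ 2 + d ≠ 0 → (x ^ 2 - d) / (x ^ 2 + d) ≠ 1 := by
    intro x hx h1
    rw [div_eq_one_iff_eq hx] at h1
    have h2d : 2 * d = 0 := by linear_combination -h1
    rcases mul_eq_zero.1 h2d with h | h
    · exact h20 h
    · exact hd h
  have hmem : ((1 : F), (0 : F)) ∈ univ.filter (fun p : F × F => p.1 ^ 2 + d * p.2 ^ 2 = 1) := by
    rw [Finset.mem_filter]; exact ⟨Finset.mem_univ _, by ring⟩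
  rw [← Finset.add_sum_erase _ _ hmem]
  congr 1
  refine (Finset.sum_bij (fun x _ => ((x ^ 2 - d) / (x ^ 2 + d), 2 * x / (x ^ 2 + d))) (fun x hx => ?_) (fun x₁ hx₁ x₂ hx₂ h => ?_) (fun p hp => ?_)
    (fun x hx => rfl)).symm
  · rw [Finset.mem_filter] at hx
    rw [Finset.mem_erase, Finset.mem_filter]
    refine ⟨fun h => hne_one x hx.2 (Prod.ext_iff.1 h).1, Finset.mem_univ _, ?_⟩
    show ((x ^ 2 - d) / (x ^ 2 + d)) ^ 2 + d * (2 * x / (x ^ 2 + d)) ^ 2 = 1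
    rw [div_pow, div_pow, mul_div_assoc', ← add_div, div_eq_one_iff_eq (pow_ne_zero 2 hx.2)]
    ring
  · rw [Finset.mem_filter] at hx₁ hx₂
    obtain ⟨h1, h2⟩ := Prod.ext_iff.1 h
    simp only at h1 h2
    have key : ∀ x : F, x ^ 2 + d ≠ 0 → d * (2 * x / (x ^ 2 + d)) = x * (1 - (x ^ 2 - d) / (x ^ 2 + d)) := fun x hx => by
      field_simp; ring
    have hne1 : (1 : F) - (x₂ ^ 2 - d) / (x₂ ^ 2 + d) ≠ 0 := sub_ne_zero.2 (Ne.symm (hne_one x₂ hx₂.2))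
    have e1 := key x₁ hx₁.2
    rw [h1, h2, key x₂ hx₂.2] at e1
    exact (mul_right_cancel₀ hne1 e1).symm
  · rw [Finset.mem_erase, Finset.mem_filter] at hp
    obtain ⟨hp1, -, hpc⟩ := hp
    have hU : 1 - p.1 ≠ 0 := by
      intro h0
      have hp1' : p.1 = 1 := by linear_combination -h0
      have hp2 : d * p.2 ^ 2 = 0 := by rw [hp1'] at hpc; linear_combination hpc
      rcases mul_eq_zero.1 hp2 with h | h
      · exact hd h
      · exact hp1 (Prod.ext hp1' (pow_eq_zero_iff two_ne_zero |>.1 h))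
    set x : F := d * p.2 / (1 - p.1) with hxval
    have hxdef : x * (1 - p.1) = d * p.2 := div_mul_cancel₀ _ hU
    have h1 : x ^ 2 * (1 - p.1) * (1 - p.1) = d * (1 + p.1) * (1 - p.1) := by
      linear_combination (x * (1 - p.1) + d * p.2) * hxdef + d * hpc
    have h2 : x ^ 2 * (1 - p.1) = d * (1 + p.1) := mul_right_cancel₀ hU h1
    have h2d : (x ^ 2 + d) * (1 - p.1) = 2 * d := by linear_combination h2
    have hx0 : x ^ 2 + d ≠ 0 := fun h0 => by
      rw [h0, zero_mul] at h2d
      exact mul_ne_zero h20 hd h2d.symm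
    refine ⟨x, ?_, ?_⟩
    · rw [Finset.mem_filter]; exact ⟨Finset.mem_univ _, hx0⟩
    · refine Prod.ext ?_ ?_
      · show (x ^ 2 - d) / (x ^ 2 + d) = p.1
        rw [div_eq_iff hx0]
        linear_combination h2d
      · show 2 * x / (x ^ 2 + d) = p.2
        rw [div_eq_iff hx0]
        refine mul_right_cancel₀ hU ?_
        linear_combination 2 * hxdef - p.2 * h2d

/-- **THE AFFINE QUARTIC ON THE CONIC: `η(2α) + Σ_x η(2(x² + d)(αx² + 2dyx + γd)) = Σ_{U² + dV² = 1} η(((α − γ)U + 2dyV) + (α + γ))`** (`d ≠ 0`, odd characteristic):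
`2(x² + d)(αx² + 2dyx + γd) = ((α + γ) + (α − γ)U + 2dyV)·(x² + d)²` at the parameter `x`, the excluded `x` (`x² = −d`) contribute `η(0) = 0`, and the point `(1,0)`
contributes `η(2α)`. [cite: LidlNiederreiter1996, Ch. 6 §2 Thm. 6.26] [cite: IrelandRosen1990, Ch. 8 §3] -/
theorem sum_quadraticChar_quartic_affine_eq_sum_unitConic (hF : ringChar F ≠ 2) {d : F} (hd : d ≠ 0) (α γ y : F) :
    quadraticChar F (2 * α) + ∑ x : F, quadraticChar F (2 * ((x ^ 2 + d) * (α * x ^ 2 + 2 * d * y * x + γ * d))) =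
      ∑ p ∈ univ.filter (fun p : F × F => p.1 ^ 2 + d * p.2 ^ 2 = 1), quadraticChar F (((α - γ) * p.1 + d * (2 * y) * p.2) + (α + γ)) := by
  rw [sum_unitConic_eq_parametrisation hF hd (fun p : F × F => quadraticChar F (((α - γ) * p.1 + d * (2 * y) * p.2) + (α + γ)))]
  dsimp only
  congr 1
  · congr 1; ring
  · have hzero : ∑ x ∈ univ.filter (fun x : F => ¬ (x ^ 2 + d ≠ 0)), quadraticChar F (2 * ((x ^ 2 + d) * (α * x ^ 2 + 2 * d * y * x + γ * d))) = 0 := by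
      refine Finset.sum_eq_zero fun x hx => ?_
      rw [Finset.mem_filter, not_not] at hx
      rw [hx.2, zero_mul, mul_zero, quadraticChar_zero]
    rw [← Finset.sum_filter_add_sum_filter_not univ (fun x : F => x ^ 2 + d ≠ 0), hzero, add_zero]
    refine Finset.sum_congr rfl fun x hx => ?_
    rw [Finset.mem_filter] at hx
    have hx2 : x ^ 2 + d ≠ 0 := hx.2
    have hsq : 2 * ((x ^ 2 + d) * (α * x ^ 2 + 2 * d * y * x + γ * d)) =
        (((α - γ) * ((x ^ 2 - d) / (x ^ 2 + d)) + d * (2 * y) * (2 * x / (x ^ 2 + d))) + (α + γ)) * (x ^ 2 + d) ^ 2 := by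
      field_simp
      ring
    rw [hsq, map_mul, map_pow, quadraticChar_sq_one hx2, mul_one]

/-! ## §4 The affine transfer identity -/

/-- **THE AFFINE QUARTIC-TO-CUBIC TRANSFER.**  For `d ≠ 0` and `D := (α − γ)² + 4dy² ≠ 0` (odd characteristic):
`η(α) + Σ_x η((x² + d)(αx² + 2dyx + γd)) = η(−2d)·Σ_v η(v + (α + γ))·η(v² − D)`.  For `γ = −α` this is ★ `quadraticChar_quartic_transfer` (`v = 2u`); in general the
right-hand side is an elliptic character sum depending on `α + γ` — the class split of the root lines of a NON-centred type-(2) block (chair RULING (17)(v)).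
[cite: LidlNiederreiter1996, Ch. 5 §4 Def. 5.49] [cite: IrelandRosen1990, Ch. 18 §2] -/
theorem quadraticChar_quartic_transfer_affine (hF : ringChar F ≠ 2) {d : F} (hd : d ≠ 0) (α γ y : F) (hD : (α - γ) ^ 2 + 4 * d * y ^ 2 ≠ 0) :
    quadraticChar F α + ∑ x : F, quadraticChar F ((x ^ 2 + d) * (α * x ^ 2 + 2 * d * y * x + γ * d)) =
      quadraticChar F (-2 * d) * ∑ v : F, quadraticChar F (v + (α + γ)) * quadraticChar F (v ^ 2 - ((α - γ) ^ 2 + 4 * d * y ^ 2)) := by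
  have h20 : (2 : F) ≠ 0 := Ring.two_ne_zero hF
  have he' : (α - γ) ^ 2 + d * (2 * y) ^ 2 ≠ 0 := by
    rw [show (α - γ) ^ 2 + d * (2 * y) ^ 2 = (α - γ) ^ 2 + 4 * d * y ^ 2 by ring]; exact hD
  have h2X : ∀ X : F, quadraticChar F X = quadraticChar F 2 * quadraticChar F (2 * X) := fun X => by
    rw [map_mul, ← mul_assoc, ← sq, quadraticChar_sq_one h20, one_mul]
  calc quadraticChar F α + ∑ x : F, quadraticChar F ((x ^ 2 + d) * (α * x ^ 2 + 2 * d * y * x + γ * d))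
      = quadraticChar F 2 * (quadraticChar F (2 * α) + ∑ x : F, quadraticChar F (2 * ((x ^ 2 + d) * (α * x ^ 2 + 2 * d * y * x + γ * d)))) := by
        rw [mul_add, Finset.mul_sum, ← h2X]
        exact congrArg _ (Finset.sum_congr rfl fun x _ => h2X _)
    _ = quadraticChar F 2 * ∑ p ∈ univ.filter (fun p : F × F => p.1 ^ 2 + d * p.2 ^ 2 = (α - γ) ^ 2 + d * (2 * y) ^ 2), quadraticChar F (p.1 + (α + γ)) := by
        rw [sum_quadraticChar_quartic_affine_eq_sum_unitConic hF hd α γ y,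
          sum_unitConic_comp_linear d (α - γ) (2 * y) he' (fun u => quadraticChar F (u + (α + γ)))]
    _ = quadraticChar F (-2 * d) * ∑ v : F, quadraticChar F (v + (α + γ)) * quadraticChar F (v ^ 2 - ((α - γ) ^ 2 + 4 * d * y ^ 2)) := by
        rw [sum_quadraticChar_fst_add_of_conic hF hd, ← mul_assoc, ← map_mul, show (2 : F) * -d = -2 * d by ring,
          show (α - γ) ^ 2 + d * (2 * y) ^ 2 = (α - γ) ^ 2 + 4 * d * y ^ 2 by ring]

end Literature.FieldTheory.FiniteFields.ConicTransfer
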